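import Summits.NavierStokesRegularity.NavierStokesRegularity.Theorems.ExtremiserTransienceLocalMaximiserDefs
import Summits.NavierStokesRegularity.NavierStokesRegularity.Theorems.ExtremiserTransienceZoneTransversalityDefs
import HarnessLib

/-!
# Route `ExtremiserTransience`, crux `NearExtremalTransiencePerFlow` (stmt-NavierStokesRegularity-26567),
# LINE g9-1 «local maximiser» (ideator ns-idea-10 g9): THE LIMIT-CLASS VOCABULARY AND THE STATEMENT OF L3 (texts of record)

Texts of record, VERBATIM the limit-class part of §1 and §3 `Sig.Extraction` of the critic-passed line file
`Cruxes/NearExtremalTransience/Lines/local_maximiser.lean` (REV 3.0/3.1; idea-crit-8 V105/V105b; the `def`s below are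
byte-identical in REV 3.0 and REV 3.1), complementing the slice-level vocabulary `sd zd wd locGain IsTestAt LocalSlack
ThickGoodCentre Selection` of `…LocalMaximiserDefs` (prover seat ns-net-p1 g14), so that the line's stub
L3 `stub_extraction : Sig.Extraction` can be stated and proved BY NAME in `Theorems/` files:
* `IsTest`, `IsLocMax` — strict admissible tests of the normalised limit and (strict) local maximality;
* `IsTestIn V θ φ`, `IsLocMaxIn κ μ V` — ROBUST (inward-or-slack, margin `θ`) tests and robust local maximality (REV 3.0);
* `HasLinearGrowth A_E V` — `∫_{B(x,R)} ‖V‖² ≤ A_E R` for all centres and radii;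
* `NearTopBounded V η' D` — uniformly bounded near-top components (used by L4/L5 only);
* `InLimitClass A A_E V` — analytic, smooth, divergence free, height `≤ 1`, `‖DʲV‖ ≤ A j`, linear growth, robust local
  maximiser of `F̃ = J − (κ⋆/2)(Z + W)`;
* `Extraction` — L3: `Selection →` every violator flow (`ZoneTransversality.IsViolator`, landed text of record) yields a field of
  the limit class with non-zero curl.
Everything is phrased over the tree's `KStar.HalfSpace` vocabulary (`E3`, `kStar`) and the landed `…LocalMaximiserDefs`; nothing new is
posited.  Author: prover seat `ns-net-p2` (g11).  HONEST FRAMING: definitions only; L3 is proved in the companion file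
`…LocalMaximiserExtraction`; nothing about Navier–Stokes regularity or blow-up is proved here; no summit is proved by a line.
-/

noncomputable section

open scoped Topology InnerProductSpace RealInnerProductSpace ENNReal ContDiff
open MeasureTheory Filter Set
open Literature.Analysis.FluidPDE
open Summit.NavierStokesRegularity.NavierStokesRegularity.Theorems.DepletionLadder.KStar.HalfSpace
open Summit.NavierStokesRegularity.NavierStokesRegularity.Theorems.DepletionLadder.KStar.BangBang
open Summit.NavierStokesRegularity.NavierStokesRegularity.Theorems.NearExtremalTransiencePerFlow.ZoneTransversality

namespace Summit.NavierStokesRegularity.NavierStokesRegularity.Theorems.NearExtremalTransiencePerFlow.LocalMaximiser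

-- the problem directory repeats the summit name (`NavierStokesRegularity/NavierStokesRegularity`)
set_option linter.dupNamespace false

/-! ## §1 (limit-class part, verbatim the line's §1) -/

/-- STRICT admissible local test for the normalised limit (`‖V + φ‖ < 1` on `tsupport φ`; strictness makes the test
admissible for all nearby fields, which is how local maximality passes to `C⁰_loc`-limits). It covers the two-sided tests
supported off the contact set AND the one-sided blob-respecting amplitude-lowering tests of L4. -/
def IsTest (V φ : E3 → E3) : Prop :=
  ContDiff ℝ (⊤ : ℕ∞) φ ∧ HasCompactSupport φ ∧ VectorCalculus.IsDivFree φ ∧ ∀ x ∈ tsupport φ, ‖V x + φ x‖ < 1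

/-- LOCAL MAXIMISER of `F̃` (constants `κ, μ`): no strict admissible local test gains. -/
def IsLocMax (κ μ : ℝ) (V : E3 → E3) : Prop := ∀ φ : E3 → E3, IsTest V φ → locGain κ μ V φ ≤ 0

/-- ROBUST (inward-or-slack) admissible test with margin `θ` (REV 3.0): smooth, compactly supported, divergence free, and at
EVERY point either SLACK `‖V + φ‖ ≤ 1 − θ` or INWARD `‖φ‖² + 2⟪V, φ⟫ ≤ −θ‖φ‖` (so `‖V + φ‖ ≤ ‖V‖`; automatic where `φ = 0`).
Both alternatives survive a `C⁰`-perturbation of `V` of size `≤ θ/2` with the SAME `φ` — this is exactly what lets local maximality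
pass to zoom limits. -/
def IsTestIn (V : E3 → E3) (θ : ℝ) (φ : E3 → E3) : Prop :=
  ContDiff ℝ (⊤ : ℕ∞) φ ∧ HasCompactSupport φ ∧ VectorCalculus.IsDivFree φ ∧
    ∀ x, ‖V x + φ x‖ ≤ 1 - θ ∨ ‖φ x‖ ^ 2 + 2 * ⟪V x, φ x⟫_ℝ ≤ -(θ * ‖φ x‖)

/-- ROBUST LOCAL MAXIMISER of `F̃` (REV 3.0; the maximality notion of the limit class): no robust admissible test gains. -/
def IsLocMaxIn (κ μ : ℝ) (V : E3 → E3) : Prop :=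
  ∀ (θ : ℝ) (φ : E3 → E3), 0 < θ → IsTestIn V θ φ → locGain κ μ V φ ≤ 0

/-- LINEAR LOCAL ENERGY GROWTH (cell units): `∫_{B(x,R)} ‖V‖² ≤ A_E·R` for all centres and radii — Seregin's bounded
scaled energy of Type-I flows, scale-invariant, inherited by zoom limits. -/
def HasLinearGrowth (A_E : ℝ) (V : E3 → E3) : Prop :=
  ∀ (x : E3) (R : ℝ), 0 < R → ∫ y in Metric.ball x R, ‖V y‖ ^ 2 ≤ A_E * R

/-- UNIFORMLY BOUNDED NEAR-TOP COMPONENTS at level `1 − η′`: every preconnected subset of `{‖V‖ > 1 − η′}` has diameter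
`≤ D` (stated pointwise — no `Metric.diam` junk value). -/
def NearTopBounded (V : E3 → E3) (η' D : ℝ) : Prop :=
  ∀ S : Set E3, IsPreconnected S → S ⊆ {x | 1 - η' < ‖V x‖} → ∀ x ∈ S, ∀ y ∈ S, dist x y ≤ D

/-- The LIMIT CLASS produced by L3 and consumed by L4/L5: analytic, smooth, divergence free, height `≤ 1`, all derivatives
bounded by the budget `A`, linear energy growth `A_E`, and a robust local maximiser of `F̃` with `κ = κ⋆`, `μ = 1`. -/
def InLimitClass (A : ℕ → ℝ) (A_E : ℝ) (V : E3 → E3) : Prop :=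
  AnalyticOnNhd ℝ V univ ∧ ContDiff ℝ (⊤ : ℕ∞) V ∧ VectorCalculus.IsDivFree V ∧ (∀ x, ‖V x‖ ≤ 1) ∧
    (∀ (j : ℕ) (x : E3), ‖iteratedFDeriv ℝ j V x‖ ≤ A j) ∧ HasLinearGrowth A_E V ∧ IsLocMaxIn kStar 1 V

/-! ## §3 The statement L3 (verbatim the line's `Sig.Extraction`) -/

/-- L3 · EXTRACTION OF AN ANALYTIC LOCAL MAXIMISER from a violator.  Given the thick-good-centre selection `Selection` (= L2 with
its slack hypothesis discharged by L1), every violator flow (`IsViolator`: certificate-free Type-I Leray–Hopf flow not extending past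
`T` for which the per-flow transience conclusion fails) yields a field in the limit class with non-zero curl.  (Verbatim the line's
`Sig.Extraction`, over the Theorems-side texts of record `Selection`, `InLimitClass`, `IsViolator`; proved in
`…LocalMaximiserExtraction` as `extraction_holds`.) -/
def Extraction : Prop :=
  Selection →
  ∀ (C ν T : ℝ) (u : ℝ → E3 → E3) (p : ℝ → E3 → ℝ), IsViolator C ν T u p →
    ∃ (A : ℕ → ℝ) (A_E : ℝ) (V : E3 → E3), (∀ j, 1 ≤ A j) ∧ 0 < A_E ∧ InLimitClass A A_E V ∧ ∃ y : E3, curl V y ≠ 0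

end Summit.NavierStokesRegularity.NavierStokesRegularity.Theorems.NearExtremalTransiencePerFlow.LocalMaximiser

end
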